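import Mathlib
import Literature.RingTheory.CohomologyAnnihilator.RegularRing
import Literature.AlgebraicGeometry.Resolution.NormalizationOfVarieties
import Literature.AlgebraicGeometry.Resolution.RankOneReductionProofs
import Summits.ResolutionOfSingularities.ResolutionOfSingularities.Theorems.HomologicalConductorPersistenceAffineChartEssFiniteType
import Summits.ResolutionOfSingularities.ResolutionOfSingularities.Theorems.SyzygyFlatteningRankOneTerminationStageNormal
import Summits.ResolutionOfSingularities.ResolutionOfSingularities.Theorems.SyzygyFlatteningHigherRankTerminationEssFiniteType
import Summits.ResolutionOfSingularities.ResolutionOfSingularities.Theorems.SyzygyFlatteningHigherRankTerminationTowerStageBasic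
import Summits.ResolutionOfSingularities.ResolutionOfSingularities.Theorems.HomologicalConductorStrictDropDimLEOne
import HarnessLib

/-!
# Persistence on the normalised `ca`-chart: reduction to one membership, regular charts, curves

Crux `HomologicalConductor.Persistence` (stmt-ResolutionOfSingularities-16484), line `birth`
(reshape 3), registered stub `stub_normalisedChartPersistence`: for `B ⊆ K` local, essentially of
finite type over `k`, `Frac B = K`, `x ∈ ca B`, `x ≠ 0`, the image of the Iyengar–Takahashi
cohomology annihilator `ca B` lies in the image of `ca (nrm (B[ca B / x]))`, where
`B[ca B / x] = k[B ∪ {c * x⁻¹ | c ∈ ca B}]` and `nrm` is the integral closure inside `K`.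

Helpers toward that stub (all folklore bookkeeping; `[OURS · L1 w44b]`, not statements of any
manuscript):

* `image_subset_image_of_mem` — **reduction to ONE membership**: for `k`-subalgebras `B`, `C` of
  `K` with `c * x⁻¹ ∈ C` for every `c ∈ ca B` (e.g. `C ⊇ B[ca B / x]`), if `x ∈ ca C` then
  `ca B ⊆ ca C` (images in `K`): `c = (c x⁻¹) · x` and `ca C` is an ideal. With its converse
  (`x ∈ ca B`), the stub is EQUIVALENT to `x ∈ ca (nrm (B[ca B / x]))`
  (`stub_iff_mem`).
* `image_subset_image_of_isRegularRing` — if `B ≤ C` and `C` is a regular ring of finite Krull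
  dimension then `ca C = C` (tree: `cohomologyAnnihilator_eq_top_of_isRegularRing`,
  [IyengarTakahashi2014, Example 2.5]), so `ca B ⊆ ca C` trivially.
* `stub_normalisedChartPersistence_of_ringKrullDim_le_one` — **the curve case of the stub**
  (extra hypothesis `ringKrullDim B ≤ 1`, otherwise the registered signature verbatim): the
  normalised chart is a noetherian integrally closed domain of dimension `≤ 1` (Krull–Akizuki,
  tree `StrictDrop.Birth.DimLEOne.ringKrullDim_le_one_of_le`), i.e. a Dedekind domain, hence a
  regular ring (Mathlib instance), and the previous item applies.

References: S. B. Iyengar, R. Takahashi, *Annihilation of cohomology and strong generation of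
module categories*, IMRN 2016 [`IyengarTakahashi2014`], Example 2.5, Lemma 2.10;
H. Matsumura, *Commutative Ring Theory*, Thm. 11.7 (Krull–Akizuki) [`Matsumura1987`].
-/

-- single-problem summit: the doubled namespace component is forced
set_option linter.dupNamespace false

noncomputable section

namespace Summit.ResolutionOfSingularities.ResolutionOfSingularities.Theorems.HomologicalConductor.PersistenceNormalisedChartRegular

open Literature.RingTheory.CohomologyAnnihilator
open Literature.AlgebraicGeometry.Resolution (isFractionRing_subalgebra_of_le)
open Summit.ResolutionOfSingularities.ResolutionOfSingularities.Theorems.SyzygyFlattening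
  (nrm self_le_nrm mem_nrm_iff isIntegrallyClosed_nrm stub_essFiniteType_nrm)
open Summit.ResolutionOfSingularities.ResolutionOfSingularities.Theorems.HomologicalConductor.PersistenceAffineChartEssFiniteType
  (stub_affineChartEssFiniteType)
open Summit.ResolutionOfSingularities.ResolutionOfSingularities.Theorems.StrictDrop.Birth.DimLEOne
  (ringKrullDim_le_one_of_le)

variable {k K : Type} [Field k] [Field K] [Algebra k K]

/-! ## Reduction of persistence to one membership -/

/-- **Reduction to one membership.** Let `B`, `C` be `k`-subalgebras of `K`, `x ≠ 0`, and suppose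
`c * x⁻¹ ∈ C` for every `c` in (the image of) `ca B` — e.g. `C ⊇ B[ca B / x]`. If `x ∈ ca C`
then `ca B ⊆ ca C` (images in `K`): `c = (c x⁻¹) · x` and `ca C` is an ideal of `C`.
[cite: IyengarTakahashi2014, Def. 2.1] -/
theorem image_subset_image_of_mem (B C : Subalgebra k K) {x : K} (hx0 : x ≠ 0)
    (hdiv : ∀ c ∈ ((↑) : ↥B → K) '' (cohomologyAnnihilator ↥B : Set ↥B), c * x⁻¹ ∈ C)
    (hx : x ∈ ((↑) : ↥C → K) '' (cohomologyAnnihilator ↥C : Set ↥C)) :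
    ((↑) : ↥B → K) '' (cohomologyAnnihilator ↥B : Set ↥B) ⊆
      ((↑) : ↥C → K) '' (cohomologyAnnihilator ↥C : Set ↥C) := by
  intro c hc
  obtain ⟨x', hx', hx'x⟩ := hx
  have hcx : c * x⁻¹ ∈ C := hdiv c hc
  refine ⟨⟨c * x⁻¹, hcx⟩ * x', Ideal.mul_mem_left _ _ hx', ?_⟩
  rw [Subalgebra.coe_mul, hx'x, mul_assoc, inv_mul_cancel₀ hx0, mul_one]

/-- Converse bookkeeping: if `ca B ⊆ ca C` (images in `K`) and `x ∈ ca B`, then `x ∈ ca C`.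
[folklore] -/
theorem mem_of_image_subset_image (B C : Subalgebra k K) {x : K}
    (hxB : x ∈ ((↑) : ↥B → K) '' (cohomologyAnnihilator ↥B : Set ↥B))
    (h : ((↑) : ↥B → K) '' (cohomologyAnnihilator ↥B : Set ↥B) ⊆
      ((↑) : ↥C → K) '' (cohomologyAnnihilator ↥C : Set ↥C)) :
    x ∈ ((↑) : ↥C → K) '' (cohomologyAnnihilator ↥C : Set ↥C) :=
  h hxB

/-- The generators `c * x⁻¹`, `c ∈ ca B`, of the affine chart `B[ca B / x]` lie in every
`k`-subalgebra containing the chart — in particular in its normalisation. [folklore] -/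
theorem mul_inv_mem_of_adjoin_le (B C : Subalgebra k K) (x : K)
    (hC : Algebra.adjoin k ((B : Set K) ∪ {y : K | ∃ c ∈ ((↑) : ↥B → K) ''
        (cohomologyAnnihilator ↥B : Set ↥B), y = c * x⁻¹}) ≤ C) :
    ∀ c ∈ ((↑) : ↥B → K) '' (cohomologyAnnihilator ↥B : Set ↥B), c * x⁻¹ ∈ C :=
  fun c hc => hC (Algebra.subset_adjoin (Or.inr ⟨c, hc, rfl⟩))

/-- **The stub is one membership.** Under `x ∈ ca B`, `x ≠ 0`, the conclusion of
`stub_normalisedChartPersistence` — `ca B ⊆ ca (nrm (B[ca B / x]))` in `K` — is equivalent to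
the single membership `x ∈ ca (nrm (B[ca B / x]))`: the ONE element `x` annihilates `Extⁱ` of
finitely generated modules over the normalised chart for `i ≫ 0`.
[cite: IyengarTakahashi2014, Def. 2.1] -/
theorem stub_iff_mem (B : Subalgebra k K) {x : K}
    (hxB : x ∈ ((↑) : ↥B → K) '' (cohomologyAnnihilator ↥B : Set ↥B)) (hx0 : x ≠ 0) :
    (((↑) : ↥B → K) '' (cohomologyAnnihilator ↥B : Set ↥B) ⊆
      ((↑) : ↥(nrm (Algebra.adjoin k ((B : Set K) ∪ {y : K | ∃ c ∈ ((↑) : ↥B → K) ''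
        (cohomologyAnnihilator ↥B : Set ↥B), y = c * x⁻¹}))) → K) ''
        (cohomologyAnnihilator ↥(nrm (Algebra.adjoin k ((B : Set K) ∪
          {y : K | ∃ c ∈ ((↑) : ↥B → K) '' (cohomologyAnnihilator ↥B : Set ↥B),
            y = c * x⁻¹}))) : Set _)) ↔
    x ∈ ((↑) : ↥(nrm (Algebra.adjoin k ((B : Set K) ∪ {y : K | ∃ c ∈ ((↑) : ↥B → K) ''
        (cohomologyAnnihilator ↥B : Set ↥B), y = c * x⁻¹}))) → K) ''
        (cohomologyAnnihilator ↥(nrm (Algebra.adjoin k ((B : Set K) ∪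
          {y : K | ∃ c ∈ ((↑) : ↥B → K) '' (cohomologyAnnihilator ↥B : Set ↥B),
            y = c * x⁻¹}))) : Set _) := by
  refine ⟨fun h => h hxB, fun h => image_subset_image_of_mem B _ hx0 ?_ h⟩
  exact mul_inv_mem_of_adjoin_le B _ x (self_le_nrm _)

/-! ## Regular targets -/

/-- **Persistence into a regular overring.** If `B ≤ C` are `k`-subalgebras of `K` and `C` is a
regular ring of finite Krull dimension, then `ca C = C`
(`cohomologyAnnihilator_eq_top_of_isRegularRing`, [IyengarTakahashi2014, Example 2.5]:
`gldim ≤ d ⟺ caᵈ⁺¹ = (1)`), so `ca B ⊆ B ⊆ C = ca C` (images in `K`).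
[cite: IyengarTakahashi2014, Example 2.5] -/
theorem image_subset_image_of_isRegularRing (B C : Subalgebra k K) (hBC : B ≤ C)
    [IsRegularRing ↥C] [FiniteRingKrullDim ↥C] :
    ((↑) : ↥B → K) '' (cohomologyAnnihilator ↥B : Set ↥B) ⊆
      ((↑) : ↥C → K) '' (cohomologyAnnihilator ↥C : Set ↥C) := by
  rintro c ⟨c', -, rfl⟩
  refine ⟨⟨(c' : K), hBC c'.2⟩, ?_, rfl⟩
  rw [cohomologyAnnihilator_eq_top_of_isRegularRing]
  exact Submodule.mem_top

/-- A `k`-subalgebra of `K` containing a subalgebra `B` which is a field with `Frac B = K` is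
itself a field: `B = K`, so every inverse lies in `B ⊆ C`. [folklore] -/
theorem isField_of_le_of_isField (B C : Subalgebra k K) (hBC : B ≤ C) [IsFractionRing ↥B K]
    (hB : IsField ↥B) : IsField ↥C := by
  have hK : ∀ z : K, z ∈ B := by
    intro z
    obtain ⟨a, s, hs, rfl⟩ := IsFractionRing.div_surjective (A := ↥B) z
    have hs0 : s ≠ 0 := nonZeroDivisors.ne_zero hs
    obtain ⟨t, ht⟩ := hB.mul_inv_cancel hs0
    have hst : (s : K) * (t : K) = 1 := by
      have h := congrArg (fun b : ↥B => (b : K)) ht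
      simpa using h
    have hinv : ((s : K))⁻¹ = (t : K) := inv_eq_of_mul_eq_one_right hst
    change (a : K) / (s : K) ∈ B
    rw [div_eq_mul_inv, hinv]
    exact mul_mem a.2 t.2
  refine { exists_pair_ne := ⟨0, 1, zero_ne_one⟩, mul_comm := mul_comm, mul_inv_cancel := ?_ }
  intro c hc
  have hc0 : (c : K) ≠ 0 := fun h => hc (Subtype.ext h)
  exact ⟨⟨(c : K)⁻¹, hBC (hK _)⟩, Subtype.ext (mul_inv_cancel₀ hc0)⟩

/-- A `k`-subalgebra of `K` of Krull dimension `≤ 1` has finite Krull dimension (it is a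
nontrivial ring, so its dimension is `≥ 0`). [folklore] -/
theorem finiteRingKrullDim_of_le_one (C : Subalgebra k K) (h : ringKrullDim ↥C ≤ 1) :
    FiniteRingKrullDim ↥C := by
  refine finiteRingKrullDim_iff_ne_bot_and_top.mpr ⟨?_, ?_⟩
  · exact ne_bot_of_le_ne_bot (by simp) (ringKrullDim_nonneg_of_nontrivial (R := ↥C))
  · refine ne_top_of_le_ne_top ?_ h
    have h1 : (((1 : ℕ) : ℕ∞) : WithBot ℕ∞) < ((⊤ : ℕ∞) : WithBot ℕ∞) :=
      WithBot.coe_lt_coe.mpr (ENat.coe_lt_top 1)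
    exact ne_of_lt h1

/-! ## The curve case of the stub -/

/-- **Curve case of `stub_normalisedChartPersistence`** (the registered signature with the one
extra hypothesis `ringKrullDim B ≤ 1`). For `B ⊆ K` essentially of finite type over `k` with
`Frac B = K` and `dim B ≤ 1`, and `x ∈ ca B`, `x ≠ 0`: the normalised chart
`C = nrm (B[ca B / x])` is essentially of finite type (tree stubs `stub_affineChartEssFiniteType`,
`stub_essFiniteType_nrm`), hence noetherian, integrally closed in `K = Frac C`
(`isIntegrallyClosed_nrm`), and of Krull dimension `≤ 1` (Krull–Akizuki,
`ringKrullDim_le_one_of_le`; if `B` is a field then `C = K`). So `C` is a Dedekind domain, hence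
a regular ring (Mathlib), `ca C = C` ([IyengarTakahashi2014, Example 2.5]) and
`ca B ⊆ B ⊆ C = ca C`. [cite: Matsumura1987, Thm. 11.7] -/
theorem stub_normalisedChartPersistence_of_ringKrullDim_le_one : ∀ (k K : Type) [Field k]
    [Field K] [Algebra k K] (B : Subalgebra k K) (x : K), Algebra.EssFiniteType k ↥B →
    IsFractionRing ↥B K → IsLocalRing ↥B → ringKrullDim ↥B ≤ 1 →
    x ∈ ((↑) : ↥B → K) ''
      (Literature.RingTheory.CohomologyAnnihilator.cohomologyAnnihilator ↥B : Set ↥B) → x ≠ 0 →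
    ((↑) : ↥B → K) '' (Literature.RingTheory.CohomologyAnnihilator.cohomologyAnnihilator ↥B :
        Set ↥B) ⊆
      ((↑) : ↥(Algebra.adjoin k {y : K | IsIntegral ↥(Algebra.adjoin k ((B : Set K) ∪
          {y : K | ∃ c ∈ ((↑) : ↥B → K) ''
            (Literature.RingTheory.CohomologyAnnihilator.cohomologyAnnihilator ↥B : Set ↥B),
            y = c * x⁻¹})) y}) → K) ''
        (Literature.RingTheory.CohomologyAnnihilator.cohomologyAnnihilator
          ↥(Algebra.adjoin k {y : K | IsIntegral ↥(Algebra.adjoin k ((B : Set K) ∪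
            {y : K | ∃ c ∈ ((↑) : ↥B → K) ''
              (Literature.RingTheory.CohomologyAnnihilator.cohomologyAnnihilator ↥B : Set ↥B),
              y = c * x⁻¹})) y}) : Set _) := by
  intro k K _ _ _ B x hBft hBfrac _ hdim _ _
  haveI := hBft
  haveI := hBfrac
  haveI : IsNoetherianRing ↥B := Algebra.EssFiniteType.isNoetherianRing k ↥B
  -- the affine chart `B' = B[ca B / x]` and its normalisation `nrm B'`
  let B' : Subalgebra k K := Algebra.adjoin k ((B : Set K) ∪
    {y : K | ∃ c ∈ ((↑) : ↥B → K) '' (cohomologyAnnihilator ↥B : Set ↥B), y = c * x⁻¹})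
  have hBB' : B ≤ B' := fun y hy => Algebra.subset_adjoin (Or.inl hy)
  have hBC : B ≤ nrm B' := hBB'.trans (self_le_nrm B')
  haveI : IsFractionRing ↥B' K := isFractionRing_subalgebra_of_le B B' hBB'
  have hB'ft : Algebra.EssFiniteType k ↥B' := stub_affineChartEssFiniteType k K B x hBft
  haveI : Algebra.EssFiniteType k ↥(nrm B') := stub_essFiniteType_nrm k K B' inferInstance hB'ft
  haveI : IsNoetherianRing ↥(nrm B') := Algebra.EssFiniteType.isNoetherianRing k _
  haveI : IsIntegrallyClosed ↥(nrm B') := isIntegrallyClosed_nrm B'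
  haveI : IsFractionRing ↥(nrm B') K := isFractionRing_subalgebra_of_le B _ hBC
  -- Krull dimension `≤ 1` upstairs (Krull–Akizuki; the field case is degenerate)
  have hdimC : ringKrullDim ↥(nrm B') ≤ 1 := by
    by_cases hF : IsField ↥B
    · have hFC : IsField ↥(nrm B') := isField_of_le_of_isField B _ hBC hF
      letI := hFC.toField
      rw [ringKrullDim_eq_zero_of_field]
      exact zero_le_one
    · exact ringKrullDim_le_one_of_le B (nrm B') hBC hdim hF
  -- so the normalised chart is a Dedekind domain, hence a regular ring
  haveI : Ring.DimensionLEOne ↥(nrm B') :=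
    Literature.AlgebraicGeometry.Resolution.Ring.DimensionLEOne.of_ringKrullDim_le_one hdimC
  haveI : IsDedekindRing ↥(nrm B') := (isDedekindRing_iff _ K).mpr
    ⟨inferInstance, inferInstance, fun hy => (isIntegrallyClosed_iff K).mp inferInstance hy⟩
  haveI : FiniteRingKrullDim ↥(nrm B') := finiteRingKrullDim_of_le_one _ hdimC
  have key : ((↑) : ↥B → K) '' (cohomologyAnnihilator ↥B : Set ↥B) ⊆
      ((↑) : ↥(nrm B') → K) '' (cohomologyAnnihilator ↥(nrm B') : Set _) :=
    image_subset_image_of_isRegularRing B (nrm B') hBC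
  exact key

end Summit.ResolutionOfSingularities.ResolutionOfSingularities.Theorems.HomologicalConductor.PersistenceNormalisedChartRegular

end
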